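import Summits.PneNP.PneNP.Theorems.ConvexRankGatesConvexGateBlindExactLiftingTriangleIsolationBlockBounds

/-!
# Triangle instance — line isolation, file 3: lines, the cube functional `ψ^x`, and its values

Support file for crux `ConvexGateBlind` (stmt-PneNP-10680), open stub `stub_exactLifting`; prover seat 0, session 22,
memo ANALYSIS12 (Theorem B). Vocabulary of the isolation theorem on top of `…TriangleLineCover`
(`Tri`, `Col`, `monoCount`, `IsMono`, `Line`, `cls`):
* `lmem L w` (the triangle `w` lies on the line `L`), `lmono x L` (the two fixed vertices of `L` have the same colour),
  and THE LINE FACTORISATION `monoCount x w = #{L mono under x through w}` (`monoCount_eq_sum_lines`);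
* the cube-inequality dual functional of the row `x`: weights `wt x w = sgn x w · dc₀ dc₁ dc₂` (`sgn = −1` exactly on
  monochromatic triangles, `dcᵢ` = number of vertices of block `i` coloured unlike `wᵢ`), `ψ^x(y) = ∑_w wt x w · y w`;
* its values: `∑_w wt = 4μ(x)` (`μ = ∏ blocks #A·#B`), `ψ^x(M_x) = 0`, `ψ^x(1_L) = 0` on monochromatic lines and
  `0 ≤ ψ^x(1_L)`, `2μ(x) ≤ t²·ψ^x(1_L)` on bichromatic ones (direction `{(a,b,·)}`; the other two directions are
  transported by block permutations in the next file).
-/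

set_option linter.dupNamespace false -- `Summit.PneNP.PneNP.…`: summit = sub-problem (D-0017)

namespace Summit.PneNP.PneNP.Theorems.XorDoor.TriLine

open Finset

noncomputable section

variable {t : ℕ}

/-! ## Lines: membership and monochromaticity -/

/-- `w` lies on the line `L` (`inl (a,b)` = `{(a,b,·)}`, `inr (inl (a,d))` = `{(a,·,d)}`, `inr (inr (b,d))` = `{(·,b,d)}`) -/
def lmem (L : Line t) (w : Tri t) : Prop :=
  Sum.elim (fun ab : Fin t × Fin t => w.1 = ab.1 ∧ w.2.1 = ab.2)
    (Sum.elim (fun ad : Fin t × Fin t => w.1 = ad.1 ∧ w.2.2 = ad.2)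
      (fun bd : Fin t × Fin t => w.2.1 = bd.1 ∧ w.2.2 = bd.2)) L

/-- the line `L` is monochromatic under `x`: its two fixed vertices have the same colour -/
def lmono (x : Col t) (L : Line t) : Prop :=
  Sum.elim (fun ab : Fin t × Fin t => x.1 ab.1 = x.2.1 ab.2)
    (Sum.elim (fun ad : Fin t × Fin t => x.1 ad.1 = x.2.2 ad.2)
      (fun bd : Fin t × Fin t => x.2.1 bd.1 = x.2.2 bd.2)) L

/-- membership in a line is decidable -/
instance (L : Line t) (w : Tri t) : Decidable (lmem L w) := by
  rcases L with ab | ad | bd <;> dsimp [lmem] <;> infer_instance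

/-- monochromaticity of a line is decidable -/
instance (x : Col t) (L : Line t) : Decidable (lmono x L) := by
  rcases L with ab | ad | bd <;> dsimp [lmono] <;> infer_instance

/-- membership in a line of direction `{(a,b,·)}` -/
@[simp] lemma lmem_inl (ab : Fin t × Fin t) (w : Tri t) : lmem (Sum.inl ab) w ↔ w.1 = ab.1 ∧ w.2.1 = ab.2 :=
  Iff.rfl
/-- membership in a line of direction `{(a,·,d)}` -/
@[simp] lemma lmem_inr_inl (ad : Fin t × Fin t) (w : Tri t) :
    lmem (Sum.inr (Sum.inl ad)) w ↔ w.1 = ad.1 ∧ w.2.2 = ad.2 := Iff.rfl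
/-- membership in a line of direction `{(·,b,d)}` -/
@[simp] lemma lmem_inr_inr (bd : Fin t × Fin t) (w : Tri t) :
    lmem (Sum.inr (Sum.inr bd)) w ↔ w.2.1 = bd.1 ∧ w.2.2 = bd.2 := Iff.rfl
/-- monochromaticity of a line of direction `{(a,b,·)}` -/
@[simp] lemma lmono_inl (x : Col t) (ab : Fin t × Fin t) : lmono x (Sum.inl ab) ↔ x.1 ab.1 = x.2.1 ab.2 := Iff.rfl
/-- monochromaticity of a line of direction `{(a,·,d)}` -/
@[simp] lemma lmono_inr_inl (x : Col t) (ad : Fin t × Fin t) :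
    lmono x (Sum.inr (Sum.inl ad)) ↔ x.1 ad.1 = x.2.2 ad.2 := Iff.rfl
/-- monochromaticity of a line of direction `{(·,b,d)}` -/
@[simp] lemma lmono_inr_inr (x : Col t) (bd : Fin t × Fin t) :
    lmono x (Sum.inr (Sum.inr bd)) ↔ x.2.1 bd.1 = x.2.2 bd.2 := Iff.rfl

/-- indicator of the line `L` -/
def lind (L : Line t) (w : Tri t) : ℝ := if lmem L w then 1 else 0

/-- **The line factorisation** `M_t[x,w] = #{monochromatic lines through w}`. -/
lemma monoCount_eq_sum_lines (x : Col t) (w : Tri t) :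
    (monoCount x w : ℝ) = ∑ L : Line t, (if lmono x L ∧ lmem L w then (1 : ℝ) else 0) := by
  obtain ⟨a, b, d⟩ := w
  rw [Fintype.sum_sum_type, Fintype.sum_sum_type]
  have h1 : ∑ ab : Fin t × Fin t, (if lmono x (Sum.inl ab) ∧ lmem (Sum.inl ab) (a, b, d) then (1 : ℝ) else 0)
      = if x.1 a = x.2.1 b then 1 else 0 := by
    rw [Fintype.sum_eq_single (a, b)]
    · simp
    · rintro ⟨a', b'⟩ h
      rw [if_neg]
      simp only [lmono_inl, lmem_inl, not_and]
      intro _ ha hb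
      exact h (by rw [ha, hb])
  have h2 : ∑ ad : Fin t × Fin t,
      (if lmono x (Sum.inr (Sum.inl ad)) ∧ lmem (Sum.inr (Sum.inl ad)) (a, b, d) then (1 : ℝ) else 0)
      = if x.1 a = x.2.2 d then 1 else 0 := by
    rw [Fintype.sum_eq_single (a, d)]
    · simp
    · rintro ⟨a', d'⟩ h
      rw [if_neg]
      simp only [lmono_inr_inl, lmem_inr_inl, not_and]
      intro _ ha hd
      exact h (by rw [ha, hd])
  have h3 : ∑ bd : Fin t × Fin t,
      (if lmono x (Sum.inr (Sum.inr bd)) ∧ lmem (Sum.inr (Sum.inr bd)) (a, b, d) then (1 : ℝ) else 0)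
      = if x.2.1 b = x.2.2 d then 1 else 0 := by
    rw [Fintype.sum_eq_single (b, d)]
    · simp
    · rintro ⟨b', d'⟩ h
      rw [if_neg]
      simp only [lmono_inr_inr, lmem_inr_inr, not_and]
      intro _ hb hd
      exact h (by rw [hb, hd])
  rw [h1, h2, h3]
  simp only [monoCount]
  push_cast
  split_ifs <;> norm_num

/-! ## The cube functional: weights and block product -/

/-- the sign of the cube functional: `−1` on monochromatic triangles, `+1` on the others -/
def sgn (x : Col t) (w : Tri t) : ℝ := if IsMono x w.1 w.2.1 w.2.2 then -1 else 1

/-- the unsigned weight `dc₀ · dc₁ · dc₂` (size of the colour class pattern complementary to that of `w`) -/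
def nw (x : Col t) (w : Tri t) : ℝ := (dc x.1 w.1 : ℝ) * (dc x.2.1 w.2.1 : ℝ) * (dc x.2.2 w.2.2 : ℝ)

/-- the weight `ω(x,w)` of the cube functional `ψ^x(y) = ∑_w ω(x,w) y(w)` -/
def wt (x : Col t) (w : Tri t) : ℝ := sgn x w * nw x w

/-- `μ(x) = ∏ blocks #A·#B` (zero exactly on degenerate colourings) -/
def mu (x : Col t) : ℝ := (cp x.1 : ℝ) * (cp x.2.1 : ℝ) * (cp x.2.2 : ℝ)

/-- the unsigned weight is non-negative -/
lemma nw_nonneg (x : Col t) (w : Tri t) : 0 ≤ nw x w := by unfold nw; positivity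

/-- `μ(x) ≥ 0` -/
lemma mu_nonneg (x : Col t) : 0 ≤ mu x := by unfold mu; positivity

/-- `|wt| ≤ nw` -/
lemma abs_wt_le (x : Col t) (w : Tri t) : |wt x w| ≤ nw x w := by
  unfold wt sgn
  split_ifs <;> simp [abs_of_nonneg (nw_nonneg x w)]

/-- a triple sum of a product factorises -/
lemma sum_tri_mul (f g h : Fin t → ℝ) :
    ∑ w : Tri t, f w.1 * g w.2.1 * h w.2.2 = (∑ a, f a) * (∑ b, g b) * (∑ d, h d) := by
  rw [Fintype.sum_prod_type, sum_mul_sum, sum_mul]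
  refine sum_congr rfl fun a _ => ?_
  rw [Fintype.sum_prod_type, sum_mul_sum]

/-- `∑_b [y b = α] dc y b = cp y`: on the class of `α`, `dc` is the size of the other class -/
lemma sum_ite_dc (y : Fin t → Bool) (α : Bool) :
    ∑ b, (if y b = α then (dc y b : ℝ) else 0) = cp y := by
  rw [← sum_filter, cp_eq y α]
  have hf : univ.filter (fun b => y b = α) = cls y α := by ext b; simp [cls]
  rw [hf]
  have : ∀ b ∈ cls y α, (dc y b : ℝ) = #(cls y (!α)) := by
    intro b hb
    rw [mem_cls] at hb
    rw [dc_eq_card_cls, hb]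
  rw [sum_congr rfl this]
  simp

/-- `∑_w dc₀ dc₁ dc₂ = 8 μ(x)` -/
lemma sum_nw (x : Col t) : ∑ w : Tri t, nw x w = 8 * mu x := by
  unfold nw mu
  rw [show ∑ w : Tri t, (dc x.1 w.1 : ℝ) * dc x.2.1 w.2.1 * dc x.2.2 w.2.2
      = (∑ a, (dc x.1 a : ℝ)) * (∑ b, (dc x.2.1 b : ℝ)) * ∑ d, (dc x.2.2 d : ℝ) from
      sum_tri_mul (fun a => (dc x.1 a : ℝ)) (fun b => (dc x.2.1 b : ℝ)) (fun d => (dc x.2.2 d : ℝ))]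
  have h : ∀ y : Fin t → Bool, ∑ a, (dc y a : ℝ) = 2 * cp y := by
    intro y; exact_mod_cast sum_dc y
  rw [h, h, h]
  ring

/-- `∑_{w mono} dc₀ dc₁ dc₂ = 2 μ(x)` -/
lemma sum_mono_nw (x : Col t) :
    ∑ w : Tri t, (if IsMono x w.1 w.2.1 w.2.2 then nw x w else 0) = 2 * mu x := by
  have key : ∀ a : Fin t, ∑ bd : Fin t × Fin t,
      (if IsMono x a bd.1 bd.2 then nw x (a, bd) else 0)
      = (dc x.1 a : ℝ) * cp x.2.1 * cp x.2.2 := by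
    intro a
    have hpt : ∀ b d, (if IsMono x a b d then nw x (a, b, d) else 0)
        = (dc x.1 a : ℝ) * ((if x.2.1 b = x.1 a then (dc x.2.1 b : ℝ) else 0)
            * (if x.2.2 d = x.1 a then (dc x.2.2 d : ℝ) else 0)) := by
      intro b d
      unfold IsMono nw
      by_cases hb : x.2.1 b = x.1 a <;> by_cases hd : x.2.2 d = x.1 a
      · rw [if_pos ⟨hb.symm, hd.symm⟩, if_pos hb, if_pos hd]; ring
      · rw [if_neg (fun hm => hd hm.2.symm), if_pos hb, if_neg hd]; ring
      · rw [if_neg (fun hm => hb hm.1.symm), if_neg hb, if_pos hd]; ring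
      · rw [if_neg (fun hm => hb hm.1.symm), if_neg hb, if_neg hd]; ring
    rw [Fintype.sum_prod_type]
    simp only [hpt]
    rw [← sum_ite_dc x.2.1 (x.1 a), ← sum_ite_dc x.2.2 (x.1 a), mul_assoc, sum_mul_sum, mul_sum]
    refine sum_congr rfl fun b _ => ?_
    rw [mul_sum]
  rw [Fintype.sum_prod_type]
  simp only [key]
  have h : ∑ a, (dc x.1 a : ℝ) = 2 * cp x.1 := by exact_mod_cast sum_dc x.1
  rw [← sum_mul, ← sum_mul, h, mu]
  ring

/-- `ψ^x(1) = ∑_w wt x w = 4 μ(x)` -/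
lemma sum_wt (x : Col t) : ∑ w : Tri t, wt x w = 4 * mu x := by
  have h : ∀ w : Tri t, wt x w = nw x w - 2 * (if IsMono x w.1 w.2.1 w.2.2 then nw x w else 0) := by
    intro w; unfold wt sgn; split_ifs <;> ring
  simp only [h, sum_sub_distrib, ← mul_sum, sum_nw, sum_mono_nw]
  ring

/-- `ψ^x(M_x) = ∑_w wt x w · monoCount x w = 0`: the cube functional kills its own row -/
lemma sum_wt_monoCount (x : Col t) : ∑ w : Tri t, wt x w * (monoCount x w : ℝ) = 0 := by
  have h : ∀ w : Tri t, wt x w * (monoCount x w : ℝ)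
      = nw x w - 4 * (if IsMono x w.1 w.2.1 w.2.2 then nw x w else 0) := by
    rintro ⟨a, b, d⟩
    unfold wt sgn
    by_cases hm : IsMono x a b d
    · rw [monoCount_of_isMono hm]; simp [hm]; ring
    · rw [monoCount_of_not_isMono hm]; simp [hm]
  simp only [h, sum_sub_distrib, ← mul_sum, sum_nw, sum_mono_nw]
  ring

/-! ## `ψ^x` on a line of direction `{(a,b,·)}` -/

/-- restricting the functional to the line `{(a,b,·)}` -/
lemma sum_wt_lind_inl (x : Col t) (a b : Fin t) :
    ∑ w : Tri t, wt x w * lind (Sum.inl (a, b)) w = ∑ d, wt x (a, b, d) := by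
  unfold lind
  rw [Fintype.sum_prod_type, Fintype.sum_eq_single a]
  · rw [Fintype.sum_prod_type, Fintype.sum_eq_single b]
    · refine sum_congr rfl fun d _ => ?_
      simp
    · intro b' hb'
      refine sum_eq_zero fun d _ => ?_
      simp [hb']
  · intro a' ha'
    refine sum_eq_zero fun bd _ => ?_
    simp [ha']

/-- on a monochromatic line `{(a,b,·)}` the functional vanishes -/
lemma sum_wt_line_inl_mono (x : Col t) {a b : Fin t} (h : x.1 a = x.2.1 b) :
    ∑ d, wt x (a, b, d) = 0 := by
  have hs : ∀ d, wt x (a, b, d)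
      = (dc x.1 a : ℝ) * dc x.2.1 b * ((if x.2.2 d = x.1 a then (-1 : ℝ) else 1) * dc x.2.2 d) := by
    intro d
    unfold wt sgn nw IsMono
    simp only [h, true_and]
    by_cases hd : x.2.2 d = x.2.1 b
    · rw [if_pos hd.symm, if_pos hd]; ring
    · rw [if_neg (Ne.symm hd), if_neg hd]; ring
  simp only [hs, ← mul_sum, sum_sign_mul_dc, mul_zero]

/-- on a bichromatic line `{(a,b,·)}` the functional equals `dc₀(a) · dc₁(b) · 2 cp₂ ≥ 0` -/
lemma sum_wt_line_inl_bichro (x : Col t) {a b : Fin t} (h : x.1 a ≠ x.2.1 b) :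
    ∑ d, wt x (a, b, d) = (dc x.1 a : ℝ) * dc x.2.1 b * (2 * cp x.2.2) := by
  have hs : ∀ d, wt x (a, b, d) = (dc x.1 a : ℝ) * dc x.2.1 b * dc x.2.2 d := by
    intro d
    unfold wt sgn nw IsMono
    rw [if_neg (fun hm => h hm.1)]
    ring
  have h2 : ∑ d, (dc x.2.2 d : ℝ) = 2 * cp x.2.2 := by exact_mod_cast sum_dc x.2.2
  simp only [hs, ← mul_sum, h2]

/-- `cp y ≤ t · dc y a`: the class not containing `a` has `dc y a` elements, the other at most `t` -/
lemma cp_le_mul_dc (y : Fin t → Bool) (a : Fin t) : (cp y : ℝ) ≤ t * dc y a := by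
  rw [cp_eq y (y a), dc_eq_card_cls]
  push_cast
  gcongr
  exact_mod_cast (card_le_univ _).trans_eq (by simp)

/-- on a bichromatic line `{(a,b,·)}`: `2 μ(x) ≤ t² · ψ^x(1_L)` -/
lemma two_mul_mu_le_inl (x : Col t) {a b : Fin t} (h : x.1 a ≠ x.2.1 b) :
    2 * mu x ≤ (t : ℝ) ^ 2 * ∑ d, wt x (a, b, d) := by
  rw [sum_wt_line_inl_bichro x h, mu]
  have h0 := cp_le_mul_dc x.1 a
  have h1 := cp_le_mul_dc x.2.1 b
  have hc : (0 : ℝ) ≤ cp x.2.2 := by positivity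
  have hd0 : (0 : ℝ) ≤ dc x.1 a := by positivity
  have hd1 : (0 : ℝ) ≤ dc x.2.1 b := by positivity
  calc 2 * ((cp x.1 : ℝ) * cp x.2.1 * cp x.2.2) = 2 * (cp x.1 * cp x.2.1) * cp x.2.2 := by ring
    _ ≤ 2 * ((t * dc x.1 a) * (t * dc x.2.1 b)) * cp x.2.2 := by gcongr
    _ = (t : ℝ) ^ 2 * ((dc x.1 a : ℝ) * dc x.2.1 b * (2 * cp x.2.2)) := by ring


/-- **Total of the cube functional** — registered sub-goal `cube_functional_total` of stmt-PneNP-10680, verbatim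
signature (see `sum_wt`): `∑_w ± N₀N₁N₂ = 4 μ(x)`, the sign being `−` exactly on the monochromatic triangles. -/
theorem cube_functional_total : ∀ (t : ℕ) (x : (Fin t → Bool) × (Fin t → Bool) × (Fin t → Bool)), ∑ w : Fin t × Fin t ×
    Fin t, (if x.1 w.1 = x.2.1 w.2.1 ∧ x.1 w.1 = x.2.2 w.2.2 then (-1 : ℝ) else 1) * ((Finset.univ.filter fun v => x.1 v
    ≠ x.1 w.1).card : ℝ) * ((Finset.univ.filter fun v => x.2.1 v ≠ x.2.1 w.2.1).card : ℝ) * ((Finset.univ.filter fun v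
    => x.2.2 v ≠ x.2.2 w.2.2).card : ℝ) = 4 * (((Finset.univ.filter fun v => x.1 v = true).card * (Finset.univ.filter
    fun v => x.1 v = false).card : ℕ) : ℝ) * (((Finset.univ.filter fun v => x.2.1 v = true).card * (Finset.univ.filter
    fun v => x.2.1 v = false).card : ℕ) : ℝ) * (((Finset.univ.filter fun v => x.2.2 v = true).card *
    (Finset.univ.filter fun v => x.2.2 v = false).card : ℕ) : ℝ) := by
  intro t x
  have h := sum_wt x
  unfold wt sgn nw mu IsMono dc cp cls at h
  calc _ = ∑ w : Tri t, (if x.1 w.1 = x.2.1 w.2.1 ∧ x.1 w.1 = x.2.2 w.2.2 then (-1 : ℝ) else 1)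
        * (((univ.filter fun v => x.1 v ≠ x.1 w.1).card : ℝ) * ((univ.filter fun v => x.2.1 v ≠ x.2.1 w.2.1).card : ℝ)
          * ((univ.filter fun v => x.2.2 v ≠ x.2.2 w.2.2).card : ℝ)) := sum_congr rfl fun w _ => by ring
    _ = _ := h
    _ = _ := by ring

end

end Summit.PneNP.PneNP.Theorems.XorDoor.TriLine
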